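import Summits.CriticalPhenomena.PercolationContinuityZ3.Theorems.SahiBoxTP2Conditioning
import Literature.Probability.LatticeModels.MTP2DensityFree
import Mathlib.Combinatorics.SetFamily.FourFunctions

/-!
# A density-free four functions theorem for set-TP₂ laws, and Holley's inequality with weights

Support file of the Sahi cell (`prim-sahi`, typer seat, generation 15; `--supports stmt-CriticalPhenomena-4575`).
Theorems only (no definitions, no named facts, no sorries).

Karlin–Rinott's continuous four functions theorem (1980, Thm. 2.1; tree `lintegral_four_functions`) is stated for
a PRODUCT reference measure: `f₁(x)f₂(y) ≤ f₃(x ∧ y)f₄(x ∨ y)` for all `x, y` implies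
`∫f₁ ∫f₂ ≤ ∫f₃ ∫f₄`; measures with an MTP₂ density are absorbed into the functions.  For the density-free notion
(Müller–Stoyan (ii) / Colangelo–Müller–Scarsini Def. 2: `μ(A)μ(B) ≤ μ(A ∧ B)μ(A ∨ B)` for all measurable
`A, B`; tree `Affiliation.mIsSetTP2`, equivalent to the cell's `IsBoxTP2` on `Q_d`, the Hilbert cube, `ℝ^d`,
`{−1,+1}^ι`) the literature gives the inequality only for indicator functions (the definition).  Here:

* `fourFunctions_of_mIsSetTP2` / `fourFunctions_of_fiber` — **THE DENSITY-FREE FOUR FUNCTIONS THEOREM**: let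
  `μ` be a finite set-TP₂ measure (resp. a finite measure with TP₂ `φ`-fibres, e.g. box-TP₂ with box fibres)
  on a distributive measurable lattice `X` with measurable singletons, and `φ_n : X → X` measurable
  LATTICE HOMOMORPHISMS with finite ranges (discretisations: dyadic floors/ceilings on `ℝ^d`, window truncations
  on `{−1,+1}^ι`).  If `f₀,…,f₃ ≥ 0` are bounded measurable, REGULAR ALONG `φ` (`f_j(φ_n x) → f_j(x)` for
  `μ`-a.e. `x`) and `f₀(x)f₁(y) ≤ f₂(x ∧ y)f₃(x ∨ y)` for all `x, y`, then `∫f₀ ∫f₁ ≤ ∫f₂ ∫f₃`.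
  Proof: the push-forward `μ ∘ φ_n⁻¹` is set-TP₂ (lit `mIsSetTP2.map_of_map_sup_inf`), finitely supported on the
  sublattice `range φ_n` with MTP₂ point masses `w`; Ahlswede–Daykin's four functions theorem on the
  distributive lattice `X` (Mathlib `four_functions_theorem`) for `w·f_j`; dominated convergence.
* `holley_setIntegral_of_mIsSetTP2` / `…_of_fiber` — **HOLLEY'S INEQUALITY WITH WEIGHTS, density-free**: for `φ`-regular
  bounded measurable `g₁, g₂ ≥ 0` with the cross condition `g₁(x)g₂(y) ≤ g₁(x ∧ y)g₂(x ∨ y)` (no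
  log-supermodularity of `g₁` or `g₂` separately!) and a `φ`-regular measurable up-set `U`:
  `(∫_U g₁ dμ)(∫ g₂ dμ) ≤ (∫ g₁ dμ)(∫_U g₂ dμ)`, i.e. the tilted laws satisfy `g₁μ/Z₁ ≤_st g₂μ/Z₂` on `U`;
  `holley_integral_of_fiber` — the same against a `φ`-regular bounded increasing `h ≥ 0`:
  `(∫ g₁ h)(∫ g₂) ≤ (∫ g₁)(∫ g₂ h)`.
* `integral_comp_eq_sum_measureReal` — bookkeeping: `∫ f ∘ φ dμ = Σ_{q ∈ range φ} μ(φ⁻¹{q}) f(q)`.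

Instances (window truncations on `{−1,+1}^ι`, Gibbs modifications of the Ising states ordered à la Holley):
companion file `SahiIsingHolley.lean`.

No sorries, no new axioms.
-/

noncomputable section

namespace Summit.CriticalPhenomena.PercolationContinuityZ3.Theorems.SahiBoxTP2

open MeasureTheory Set Filter Topology Function
open Literature.Probability.LatticeModels Literature.Probability.LatticeModels.Affiliation
open scoped ENNReal

section FourFunctions

variable {X : Type*} [MeasurableSpace X] [MeasurableSingletonClass X]

/-- **Integral against a map with finite range**: `∫ f(φ x) dμ = Σ_{q ∈ s} μ(φ⁻¹{q}) f(q)` for any finite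
`s ⊇ range φ`. [folklore] -/
theorem integral_comp_eq_sum_measureReal (μ : Measure X) [IsFiniteMeasure μ] {φ : X → X} (hφ : Measurable φ)
    (s : Finset X) (hs : ∀ x, φ x ∈ s) (f : X → ℝ) :
    ∫ x, f (φ x) ∂μ = ∑ q ∈ s, μ.real (φ ⁻¹' {q}) * f q := by
  classical
  have hpt : ∀ x, f (φ x) = ∑ q ∈ s, (φ ⁻¹' {q}).indicator (fun _ => f q) x := by
    intro x
    rw [Finset.sum_eq_single (φ x)]
    · rw [indicator_of_mem (mem_preimage.2 (mem_singleton _))]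
    · intro q _ hq
      exact indicator_of_notMem (fun h => hq (mem_singleton_iff.1 (mem_preimage.1 h)).symm) _
    · exact fun h => absurd (hs x) h
  simp_rw [hpt]
  rw [integral_finsetSum _ fun q _ => (integrable_const (f q)).indicator (hφ (measurableSet_singleton q))]
  refine Finset.sum_congr rfl fun q _ => ?_
  rw [integral_indicator_const _ (hφ (measurableSet_singleton q)), smul_eq_mul]

variable [DistribLattice X]

/-- **The four functions inequality at one discretisation level**: for a finite measure `μ`, a measurable
lattice homomorphism `φ` with finite range whose FIBRES are TP₂ (`μ(φ⁻¹a)μ(φ⁻¹b) ≤ μ(φ⁻¹(a ∧ b))μ(φ⁻¹(a ∨ b))`,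
automatic for set-TP₂ `μ`, and for box-TP₂ `μ` when the fibres are boxes) and `f₀,…,f₃ ≥ 0` with
`f₀(x)f₁(y) ≤ f₂(x ∧ y)f₃(x ∨ y)`:  `∫f₀∘φ ∫f₁∘φ ≤ ∫f₂∘φ ∫f₃∘φ` (Ahlswede–Daykin on the sublattice `range φ`
with the point masses of `μ ∘ φ⁻¹`). [this work] -/
theorem fourFunctions_comp_of_fiber (μ : Measure X) [IsFiniteMeasure μ] {φ : X → X} (hφ : Measurable φ)
    (hinf : ∀ x y, φ (x ⊓ y) = φ x ⊓ φ y) (hsup : ∀ x y, φ (x ⊔ y) = φ x ⊔ φ y) (hfin : (range φ).Finite)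
    (hw : ∀ a b, μ (φ ⁻¹' {a}) * μ (φ ⁻¹' {b}) ≤ μ (φ ⁻¹' {a ⊓ b}) * μ (φ ⁻¹' {a ⊔ b}))
    (f : Fin 4 → X → ℝ) (hf0 : ∀ j x, 0 ≤ f j x) (h : ∀ x y, f 0 x * f 1 y ≤ f 2 (x ⊓ y) * f 3 (x ⊔ y)) :
    (∫ x, f 0 (φ x) ∂μ) * (∫ x, f 1 (φ x) ∂μ) ≤ (∫ x, f 2 (φ x) ∂μ) * (∫ x, f 3 (φ x) ∂μ) := by
  classical
  set s := hfin.toFinset with hs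
  have hmem : ∀ x, φ x ∈ s := fun x => hfin.mem_toFinset.2 (mem_range_self x)
  have hsc : InfClosed (s : Set X) := by
    rw [hs, hfin.coe_toFinset]
    rintro _ ⟨x, rfl⟩ _ ⟨y, rfl⟩
    exact ⟨x ⊓ y, hinf x y⟩
  have hsc' : SupClosed (s : Set X) := by
    rw [hs, hfin.coe_toFinset]
    rintro _ ⟨x, rfl⟩ _ ⟨y, rfl⟩
    exact ⟨x ⊔ y, hsup x y⟩
  -- `s ⊼ s = s`, `s ⊻ s = s` (Mathlib's scoped `Finset` lattice operations, not activated here)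
  have hsinf := (Finset.infs_self (s := s)).2 hsc
  have hssup := (Finset.sups_eq_self (s := s)).2 hsc'
  simp only [integral_comp_eq_sum_measureReal μ hφ s hmem]
  set w : X → ℝ := fun q => μ.real (φ ⁻¹' {q}) with hw_def
  have hw0 : ∀ q, 0 ≤ w q := fun q => measureReal_nonneg
  have hw' : ∀ a b, w a * w b ≤ w (a ⊓ b) * w (a ⊔ b) := fun a b => by
    simp only [hw_def, measureReal_def, ← ENNReal.toReal_mul]
    exact ENNReal.toReal_mono (ENNReal.mul_ne_top (measure_ne_top _ _) (measure_ne_top _ _)) (hw a b)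
  have key := four_functions_theorem (fun q => w q * f 0 q) (fun q => w q * f 1 q) (fun q => w q * f 2 q)
    (fun q => w q * f 3 q) (fun q => mul_nonneg (hw0 q) (hf0 0 q)) (fun q => mul_nonneg (hw0 q) (hf0 1 q))
    (fun q => mul_nonneg (hw0 q) (hf0 2 q)) (fun q => mul_nonneg (hw0 q) (hf0 3 q)) (fun a b => ?_) s s
  · rwa [hsinf, hssup] at key
  · calc w a * f 0 a * (w b * f 1 b) = (w a * w b) * (f 0 a * f 1 b) := mul_mul_mul_comm _ _ _ _
      _ ≤ (w (a ⊓ b) * w (a ⊔ b)) * (f 2 (a ⊓ b) * f 3 (a ⊔ b)) :=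
          mul_le_mul (hw' a b) (h a b) (mul_nonneg (hf0 0 a) (hf0 1 b)) (mul_nonneg (hw0 _) (hw0 _))
      _ = w (a ⊓ b) * f 2 (a ⊓ b) * (w (a ⊔ b) * f 3 (a ⊔ b)) := mul_mul_mul_comm _ _ _ _

/-- The fibres of a measurable lattice homomorphism under a set-TP₂ measure are TP₂. [folklore] -/
theorem fiber_mul_le_of_mIsSetTP2 (μ : Measure X) (hμ : mIsSetTP2 μ) {φ : X → X} (hφ : Measurable φ)
    (hinf : ∀ x y, φ (x ⊓ y) = φ x ⊓ φ y) (hsup : ∀ x y, φ (x ⊔ y) = φ x ⊔ φ y) (a b : X) :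
    μ (φ ⁻¹' {a}) * μ (φ ⁻¹' {b}) ≤ μ (φ ⁻¹' {a ⊓ b}) * μ (φ ⁻¹' {a ⊔ b}) := by
  have h := mIsSetTP2.map_of_map_sup_inf hμ hφ hsup hinf (measurableSet_singleton a) (measurableSet_singleton b)
  rwa [Set.singleton_infs_singleton, Set.singleton_sups_singleton, Measure.map_apply hφ (measurableSet_singleton _),
    Measure.map_apply hφ (measurableSet_singleton _), Measure.map_apply hφ (measurableSet_singleton _),
    Measure.map_apply hφ (measurableSet_singleton _)] at h

/-- **THE DENSITY-FREE FOUR FUNCTIONS THEOREM (fibre form).**  `μ` finite; `φ_n` measurable lattice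
homomorphisms with finite ranges and TP₂ fibres.  If `f₀,…,f₃ ≥ 0` are bounded, measurable, regular along `φ`
(`f_j(φ_n x) → f_j(x)` for `μ`-a.e. `x`) and `f₀(x)f₁(y) ≤ f₂(x ∧ y)f₃(x ∨ y)` for all `x, y`, then
`(∫f₀ dμ)(∫f₁ dμ) ≤ (∫f₂ dμ)(∫f₃ dμ)`. [this work] -/
theorem fourFunctions_of_fiber (μ : Measure X) [IsFiniteMeasure μ] (φ : ℕ → X → X)
    (hφ : ∀ n, Measurable (φ n)) (hinf : ∀ n x y, φ n (x ⊓ y) = φ n x ⊓ φ n y)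
    (hsup : ∀ n x y, φ n (x ⊔ y) = φ n x ⊔ φ n y) (hfin : ∀ n, (range (φ n)).Finite)
    (hw : ∀ n a b, μ (φ n ⁻¹' {a}) * μ (φ n ⁻¹' {b}) ≤ μ (φ n ⁻¹' {a ⊓ b}) * μ (φ n ⁻¹' {a ⊔ b}))
    (f : Fin 4 → X → ℝ) (hf0 : ∀ j x, 0 ≤ f j x) (hfm : ∀ j, Measurable (f j)) {C : ℝ}
    (hfC : ∀ j x, f j x ≤ C) (hreg : ∀ j, ∀ᵐ x ∂μ, Tendsto (fun n => f j (φ n x)) atTop (𝓝 (f j x)))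
    (h : ∀ x y, f 0 x * f 1 y ≤ f 2 (x ⊓ y) * f 3 (x ⊔ y)) :
    (∫ x, f 0 x ∂μ) * (∫ x, f 1 x ∂μ) ≤ (∫ x, f 2 x ∂μ) * (∫ x, f 3 x ∂μ) := by
  have hlim : ∀ j, Tendsto (fun n => ∫ x, f j (φ n x) ∂μ) atTop (𝓝 (∫ x, f j x ∂μ)) := by
    intro j
    refine tendsto_integral_of_dominated_convergence (fun _ => C) (fun n => ?_) (integrable_const C)
      (fun n => Eventually.of_forall fun x => ?_) (hreg j)
    · exact ((hfm j).comp (hφ n)).aestronglyMeasurable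
    · rw [Real.norm_eq_abs, abs_of_nonneg (hf0 j _)]
      exact hfC j _
  exact le_of_tendsto_of_tendsto' ((hlim 0).mul (hlim 1)) ((hlim 2).mul (hlim 3)) fun n =>
    fourFunctions_comp_of_fiber μ (hφ n) (hinf n) (hsup n) (hfin n) (hw n) f hf0 h

/-- **THE DENSITY-FREE FOUR FUNCTIONS THEOREM** for set-TP₂ measures (Müller–Stoyan (ii) /
Colangelo–Müller–Scarsini Def. 2) on a distributive measurable lattice with measurable singletons, along any
discretisation scheme `φ_n` of measurable lattice homomorphisms with finite ranges. [this work] -/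
theorem fourFunctions_of_mIsSetTP2 (μ : Measure X) [IsFiniteMeasure μ] (hμ : mIsSetTP2 μ)
    (φ : ℕ → X → X) (hφ : ∀ n, Measurable (φ n)) (hinf : ∀ n x y, φ n (x ⊓ y) = φ n x ⊓ φ n y)
    (hsup : ∀ n x y, φ n (x ⊔ y) = φ n x ⊔ φ n y) (hfin : ∀ n, (range (φ n)).Finite) (f : Fin 4 → X → ℝ)
    (hf0 : ∀ j x, 0 ≤ f j x) (hfm : ∀ j, Measurable (f j)) {C : ℝ} (hfC : ∀ j x, f j x ≤ C)
    (hreg : ∀ j, ∀ᵐ x ∂μ, Tendsto (fun n => f j (φ n x)) atTop (𝓝 (f j x)))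
    (h : ∀ x y, f 0 x * f 1 y ≤ f 2 (x ⊓ y) * f 3 (x ⊔ y)) :
    (∫ x, f 0 x ∂μ) * (∫ x, f 1 x ∂μ) ≤ (∫ x, f 2 x ∂μ) * (∫ x, f 3 x ∂μ) :=
  fourFunctions_of_fiber μ φ hφ hinf hsup hfin (fun n => fiber_mul_le_of_mIsSetTP2 μ hμ (hφ n) (hinf n) (hsup n))
    f hf0 hfm hfC hreg h

/-! ### Holley's inequality with weights, density-free -/

/-- **Holley's inequality with weights (events), density-free, fibre form.**  `μ` finite, `φ_n` a
discretisation scheme with TP₂ fibres as above; `g₁, g₂ ≥ 0` bounded measurable `φ`-regular with the CROSS condition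
`g₁(x)g₂(y) ≤ g₁(x ∧ y)g₂(x ∨ y)`; `U` a measurable up-set whose indicator is `φ`-regular.  Then
`(∫_U g₁ dμ)(∫ g₂ dμ) ≤ (∫ g₁ dμ)(∫_U g₂ dμ)`: the normalised tilts are stochastically ordered on `U`.
(Finite strictly positive case: Holley 1974 / Mathlib `holley`; here neither `g₁` nor `g₂` need be
log-supermodular and `μ` may be singular.) [this work] -/
theorem holley_setIntegral_of_fiber (μ : Measure X) [IsFiniteMeasure μ]
    (φ : ℕ → X → X) (hφ : ∀ n, Measurable (φ n)) (hinf : ∀ n x y, φ n (x ⊓ y) = φ n x ⊓ φ n y)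
    (hsup : ∀ n x y, φ n (x ⊔ y) = φ n x ⊔ φ n y) (hfin : ∀ n, (range (φ n)).Finite)
    (hw : ∀ n a b, μ (φ n ⁻¹' {a}) * μ (φ n ⁻¹' {b}) ≤ μ (φ n ⁻¹' {a ⊓ b}) * μ (φ n ⁻¹' {a ⊔ b}))
    {g₁ g₂ : X → ℝ}
    (hg₁0 : ∀ x, 0 ≤ g₁ x) (hg₂0 : ∀ x, 0 ≤ g₂ x) (hg₁m : Measurable g₁) (hg₂m : Measurable g₂) {C : ℝ}
    (hg₁C : ∀ x, g₁ x ≤ C) (hg₂C : ∀ x, g₂ x ≤ C)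
    (hg₁r : ∀ᵐ x ∂μ, Tendsto (fun n => g₁ (φ n x)) atTop (𝓝 (g₁ x)))
    (hg₂r : ∀ᵐ x ∂μ, Tendsto (fun n => g₂ (φ n x)) atTop (𝓝 (g₂ x)))
    (hcross : ∀ x y, g₁ x * g₂ y ≤ g₁ (x ⊓ y) * g₂ (x ⊔ y)) {U : Set X} (hU : IsUpperSet U)
    (hUm : MeasurableSet U)
    (hUr : ∀ᵐ x ∂μ, Tendsto (fun n => U.indicator (1 : X → ℝ) (φ n x)) atTop (𝓝 (U.indicator 1 x))) :
    (∫ x in U, g₁ x ∂μ) * (∫ x, g₂ x ∂μ) ≤ (∫ x, g₁ x ∂μ) * (∫ x in U, g₂ x ∂μ) := by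
  classical
  have hind : ∀ (g : X → ℝ) x, U.indicator g x = U.indicator (1 : X → ℝ) x * g x := fun g x => by
    by_cases hx : x ∈ U
    · simp [indicator_of_mem hx]
    · simp [indicator_of_notMem hx]
  have key := fourFunctions_of_fiber μ φ hφ hinf hsup hfin hw ![U.indicator g₁, g₂, g₁, U.indicator g₂]
    (fun j x => by
      fin_cases j
      · exact indicator_nonneg (fun y _ => hg₁0 y) x
      · exact hg₂0 x
      · exact hg₁0 x
      · exact indicator_nonneg (fun y _ => hg₂0 y) x)
    (fun j => by
      fin_cases j
      · exact hg₁m.indicator hUm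
      · exact hg₂m
      · exact hg₁m
      · exact hg₂m.indicator hUm)
    (C := C) (fun j x => by
      fin_cases j
      · exact (Set.indicator_le_self' (fun y _ => hg₁0 y) x).trans (hg₁C x)
      · exact hg₂C x
      · exact hg₁C x
      · exact (Set.indicator_le_self' (fun y _ => hg₂0 y) x).trans (hg₂C x))
    (fun j => by
      fin_cases j
      · show ∀ᵐ x ∂μ, Tendsto (fun n => U.indicator g₁ (φ n x)) atTop (𝓝 (U.indicator g₁ x))
        filter_upwards [hg₁r, hUr] with x hx hxU
        simp only [hind g₁]
        exact hxU.mul hx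
      · exact hg₂r
      · exact hg₁r
      · show ∀ᵐ x ∂μ, Tendsto (fun n => U.indicator g₂ (φ n x)) atTop (𝓝 (U.indicator g₂ x))
        filter_upwards [hg₂r, hUr] with x hx hxU
        simp only [hind g₂]
        exact hxU.mul hx)
    (fun x y => by
      show U.indicator g₁ x * g₂ y ≤ g₁ (x ⊓ y) * U.indicator g₂ (x ⊔ y)
      by_cases hx : x ∈ U
      · rw [indicator_of_mem hx, indicator_of_mem (hU le_sup_left hx)]
        exact hcross x y
      · rw [indicator_of_notMem hx, zero_mul]
        exact mul_nonneg (hg₁0 _) (indicator_nonneg (fun z _ => hg₂0 z) _))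
  change (∫ x, U.indicator g₁ x ∂μ) * (∫ x, g₂ x ∂μ) ≤ (∫ x, g₁ x ∂μ) * (∫ x, U.indicator g₂ x ∂μ) at key
  rwa [integral_indicator hUm, integral_indicator hUm] at key

/-- **Holley's inequality with weights against a function, fibre form**: with `g₁, g₂` as above and a
`φ`-regular bounded measurable increasing `h ≥ 0`, `(∫ g₁ h dμ)(∫ g₂ dμ) ≤ (∫ g₁ dμ)(∫ g₂ h dμ)`. [this work] -/
theorem holley_integral_of_fiber (μ : Measure X) [IsFiniteMeasure μ]
    (φ : ℕ → X → X) (hφ : ∀ n, Measurable (φ n)) (hinf : ∀ n x y, φ n (x ⊓ y) = φ n x ⊓ φ n y)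
    (hsup : ∀ n x y, φ n (x ⊔ y) = φ n x ⊔ φ n y) (hfin : ∀ n, (range (φ n)).Finite)
    (hw : ∀ n a b, μ (φ n ⁻¹' {a}) * μ (φ n ⁻¹' {b}) ≤ μ (φ n ⁻¹' {a ⊓ b}) * μ (φ n ⁻¹' {a ⊔ b}))
    {g₁ g₂ h : X → ℝ} (hg₁0 : ∀ x, 0 ≤ g₁ x) (hg₂0 : ∀ x, 0 ≤ g₂ x) (hh0 : ∀ x, 0 ≤ h x)
    (hg₁m : Measurable g₁) (hg₂m : Measurable g₂) (hhm : Measurable h) {C : ℝ} (hg₁C : ∀ x, g₁ x ≤ C)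
    (hg₂C : ∀ x, g₂ x ≤ C) (hhC : ∀ x, h x ≤ C) (hC1 : 1 ≤ C)
    (hg₁r : ∀ᵐ x ∂μ, Tendsto (fun n => g₁ (φ n x)) atTop (𝓝 (g₁ x)))
    (hg₂r : ∀ᵐ x ∂μ, Tendsto (fun n => g₂ (φ n x)) atTop (𝓝 (g₂ x)))
    (hhr : ∀ᵐ x ∂μ, Tendsto (fun n => h (φ n x)) atTop (𝓝 (h x))) (hh : Monotone h)
    (hcross : ∀ x y, g₁ x * g₂ y ≤ g₁ (x ⊓ y) * g₂ (x ⊔ y)) :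
    (∫ x, g₁ x * h x ∂μ) * (∫ x, g₂ x ∂μ) ≤ (∫ x, g₁ x ∂μ) * (∫ x, g₂ x * h x ∂μ) := by
  have key := fourFunctions_of_fiber μ φ hφ hinf hsup hfin hw ![fun x => g₁ x * h x, g₂, g₁, fun x => g₂ x * h x]
    (fun j x => by
      fin_cases j
      · exact mul_nonneg (hg₁0 x) (hh0 x)
      · exact hg₂0 x
      · exact hg₁0 x
      · exact mul_nonneg (hg₂0 x) (hh0 x))
    (fun j => by
      fin_cases j
      · exact hg₁m.mul hhm
      · exact hg₂m
      · exact hg₁m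
      · exact hg₂m.mul hhm)
    (C := C * C) (fun j x => by
      fin_cases j
      · exact mul_le_mul (hg₁C x) (hhC x) (hh0 x) ((hg₁0 x).trans (hg₁C x))
      · exact (hg₂C x).trans (le_mul_of_one_le_right ((hg₂0 x).trans (hg₂C x)) hC1)
      · exact (hg₁C x).trans (le_mul_of_one_le_right ((hg₁0 x).trans (hg₁C x)) hC1)
      · exact mul_le_mul (hg₂C x) (hhC x) (hh0 x) ((hg₂0 x).trans (hg₂C x)))
    (fun j => by
      fin_cases j
      · show ∀ᵐ x ∂μ, Tendsto (fun n => g₁ (φ n x) * h (φ n x)) atTop (𝓝 (g₁ x * h x))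
        filter_upwards [hg₁r, hhr] with x hx hxh
        exact hx.mul hxh
      · exact hg₂r
      · exact hg₁r
      · show ∀ᵐ x ∂μ, Tendsto (fun n => g₂ (φ n x) * h (φ n x)) atTop (𝓝 (g₂ x * h x))
        filter_upwards [hg₂r, hhr] with x hx hxh
        exact hx.mul hxh)
    (fun x y => by
      show g₁ x * h x * g₂ y ≤ g₁ (x ⊓ y) * (g₂ (x ⊔ y) * h (x ⊔ y))
      calc g₁ x * h x * g₂ y = (g₁ x * g₂ y) * h x := by ring
        _ ≤ (g₁ (x ⊓ y) * g₂ (x ⊔ y)) * h (x ⊔ y) :=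
            mul_le_mul (hcross x y) (hh le_sup_left) (hh0 x) (mul_nonneg (hg₁0 _) (hg₂0 _))
        _ = g₁ (x ⊓ y) * (g₂ (x ⊔ y) * h (x ⊔ y)) := by ring)
  exact key

/-- **Holley's inequality with weights (events)** for set-TP₂ measures. [this work] -/
theorem holley_setIntegral_of_mIsSetTP2 (μ : Measure X) [IsFiniteMeasure μ] (hμ : mIsSetTP2 μ)
    (φ : ℕ → X → X) (hφ : ∀ n, Measurable (φ n)) (hinf : ∀ n x y, φ n (x ⊓ y) = φ n x ⊓ φ n y)
    (hsup : ∀ n x y, φ n (x ⊔ y) = φ n x ⊔ φ n y) (hfin : ∀ n, (range (φ n)).Finite) {g₁ g₂ : X → ℝ}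
    (hg₁0 : ∀ x, 0 ≤ g₁ x) (hg₂0 : ∀ x, 0 ≤ g₂ x) (hg₁m : Measurable g₁) (hg₂m : Measurable g₂) {C : ℝ}
    (hg₁C : ∀ x, g₁ x ≤ C) (hg₂C : ∀ x, g₂ x ≤ C)
    (hg₁r : ∀ᵐ x ∂μ, Tendsto (fun n => g₁ (φ n x)) atTop (𝓝 (g₁ x)))
    (hg₂r : ∀ᵐ x ∂μ, Tendsto (fun n => g₂ (φ n x)) atTop (𝓝 (g₂ x)))
    (hcross : ∀ x y, g₁ x * g₂ y ≤ g₁ (x ⊓ y) * g₂ (x ⊔ y)) {U : Set X} (hU : IsUpperSet U)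
    (hUm : MeasurableSet U)
    (hUr : ∀ᵐ x ∂μ, Tendsto (fun n => U.indicator (1 : X → ℝ) (φ n x)) atTop (𝓝 (U.indicator 1 x))) :
    (∫ x in U, g₁ x ∂μ) * (∫ x, g₂ x ∂μ) ≤ (∫ x, g₁ x ∂μ) * (∫ x in U, g₂ x ∂μ) :=
  holley_setIntegral_of_fiber μ φ hφ hinf hsup hfin
    (fun n => fiber_mul_le_of_mIsSetTP2 μ hμ (hφ n) (hinf n) (hsup n)) hg₁0 hg₂0 hg₁m hg₂m hg₁C hg₂C hg₁r
    hg₂r hcross hU hUm hUr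

end FourFunctions

end Summit.CriticalPhenomena.PercolationContinuityZ3.Theorems.SahiBoxTP2
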